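import Mathlib
import Summits.ResolutionOfSingularities.ResolutionOfSingularities.Theorems.HomologicalConductorPersistenceSurfaceHullCover
import HarnessLib

/-!
# Rung S-2 `PersistenceSurface` (stmt-ResolutionOfSingularities-19970) — the TRANSFER OF STABLE ANNIHILATORS TO A
# SPLIT SUBRING WITHOUT A REYNOLDS AVERAGE: graded (weight) decompositions instead of characters, so that the
# cyclic-quotient floor needs neither `n ∈ kˣ` nor a root of unity (towards K-PCC F5/F6, res-L1-w44b-tri-2 TRIAGE v18 R67)

Route `ResolutionOfSingularities/HomologicalConductor`, chain W4.4b (cell res-hironaka; seat res-L1-w44b-stub-1 gen 6).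
`[OURS · L1 w44b]` replaces the role of no printed item; NOT a statement of the manuscript under review (Hironaka
2017), nothing here is attributed to its author; folklore algebra, AI-written (weaker than expert review).

## What and why

Stub-4's T-V transfer package (`…PersistenceCyclicTransfer*`, parts 1–13; the engines' criterion
`PersistenceCyclicQuotientSurfaceFinite.monomial_mem_cohomologyAnnihilatorOfDegree_three'` at every cyclic arrival
`1/n(1,q)`) is built on a finite GROUP `G` acting on `V` with fixed ring `U`, `U`-valued CHARACTERS and the
Reynolds average — whence the standing hypotheses `|G| ∈ Uˣ` and a primitive `n`-th root of unity (TAME quotients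
only: `p ∤ n`; flagged by res-L1-w44b-tri-2 TRIAGE v18 R67 and K-PCC F5/F6 — the rung quantifies over EVERY `p`).
The averaging is used for one thing: to produce an identity

  `∑ₗ bₗ · ρ(b′ₗ · w) = a · w   (∀ w ∈ V)`                                                    (AVG)

for a `U`-linear splitting `ρ : V → U` of `U → V` and finitely many `bₗ, b′ₗ ∈ V`.  This file shows (§1) that (AVG)
ALONE transfers stable annihilation — for ANY `c ∈ V` with `c • 𝟙_M` stably zero over `V` and ANY `U`-linear retract
`N` of `M|_U`, `u := a·c ∈ U` stably annihilates `N` over `U` — and (§2) that (AVG) comes for free from a GRADING: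
if `V = ⊕_{x ∈ G} V_x` as `U`-modules (`G` a finite additive group, `V_x V_y ⊆ V_{x+y}`, `V_0 = U`, `ρ` = the degree-`0`
part), then every `a` admitting, for each `x`, a decomposition `a = ∑ₖ bₖ b′ₖ` with `b′ₖ ∈ V_{−x}` satisfies (AVG).  No
division by `|G|`, no root of unity, no group: for `U = k[u,v]^{(n,q)} ⊂ V = k[u,v]` graded by the weight
`i + qj mod n` this is the engines' decomposition datum `a ∈ ⋂ₓ M_x · M_{−x}` in EVERY characteristic, `p ∣ n` included
(the instantiation — degree-`0` part = `U`, coinduced modules, the Frobenius hypothesis — follows stub-4's parts 10–13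
with these two lemmas in place of parts 8–9; not in this file).

* §1 `exists_comp_eq_smul_id_of_averaging'` (free form, index `L × Fin s`), `stablyAnnihilates_of_linearMap_fintype`
  (bridge for any finite index type), `StablyAnnihilates.of_averaging` (CA-layer form).
* §2 `proj_zero_mul_eq_of_graded` (`e₀(b′·w) = b′·eₓ(w)` for `b′ ∈ V_{−x}`), `averaging_of_graded` ((AVG) from a
  grading and decompositions), `StablyAnnihilates.of_graded` (the two combined).

References (mechanism only): S. B. Iyengar, R. Takahashi, IMRN 2016, arXiv:1404.1476, Remark 2.13
[`IyengarTakahashi2014`]; M. Auslander, Trans. AMS 293 (1986) (the `|G| ∈ kˣ` argument being replaced).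
-/

noncomputable section

-- single-problem summit: the doubled namespace component `ResolutionOfSingularities` is forced
set_option linter.dupNamespace false

namespace Summit.ResolutionOfSingularities.ResolutionOfSingularities.Theorems.HomologicalConductor.PersistenceGradedTransfer

open Finset
open Summit.ResolutionOfSingularities.ResolutionOfSingularities.Theorems.NoZeno.SandwichCluster
open Summit.ResolutionOfSingularities.ResolutionOfSingularities.Theorems.HomologicalConductor.PersistenceSurfaceHullCover

universe u

/-! ## §1 Transfer from an averaging identity -/

section Averaging

variable {U V : Type u} [CommRing U] [CommRing V] [Algebra U V]

/-- **TRANSFER FROM AN AVERAGING IDENTITY (free form).**  Let `ρ : V → U` be `U`-linear and `bₗ, b′ₗ ∈ V`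
(`l ∈ L` finite) with `∑ₗ bₗ · ρ(b′ₗ · w) = a · w` for all `w ∈ V`.  Let `M` be a `V`-module, `N` a `U`-module with
`U`-linear `j : N → M`, `q : M → N`, `q ∘ j = id`, and `π ∘ ι = c • id_M` a factorisation through `Fin s → V` over `V`.
If `algebraMap u = a·c` then `u • id_N` factors `U`-linearly through `L × Fin s → U`:
`n ↦ (ρ(b′ₗ · ι(j n)ᵢ))_{l,i} ↦ q(π(∑ₗ bₗ · —))`.  [folklore mechanism, Reynolds-free] -/
theorem exists_comp_eq_smul_id_of_averaging' (ρ : V →ₗ[U] U) {L : Type*} [Fintype L] (b b' : L → V) (a : V)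
    (havg : ∀ w : V, ∑ l, b l * algebraMap U V (ρ (b' l * w)) = a * w)
    {M : Type u} [AddCommGroup M] [Module V M] [Module U M] [IsScalarTower U V M]
    {N : Type u} [AddCommGroup N] [Module U N] (j : N →ₗ[U] M) (q : M →ₗ[U] N) (hqj : ∀ n, q (j n) = n)
    {c : V} {s : ℕ} (ι : M →ₗ[V] (Fin s → V)) (π : (Fin s → V) →ₗ[V] M) (hπι : π ∘ₗ ι = c • LinearMap.id)
    (u : U) (hu : algebraMap U V u = a * c) :
    ∃ (f' : N →ₗ[U] (L × Fin s → U)) (g' : (L × Fin s → U) →ₗ[U] N), g' ∘ₗ f' = u • LinearMap.id := by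
  -- `f' n (l, i) = ρ (b′ₗ · ι(j n)ᵢ)`
  let f' : N →ₗ[U] (L × Fin s → U) :=
    { toFun := fun n li => ρ (b' li.1 * ι (j n) li.2)
      map_add' := fun n n' => by
        funext li
        simp only [map_add, Pi.add_apply, mul_add]
      map_smul' := fun r n => by
        funext li
        simp only [LinearMap.map_smul_of_tower, Pi.smul_apply, RingHom.id_apply]
        rw [← ρ.map_smul]
        congr 1
        rw [Algebra.smul_def, Algebra.smul_def]
        ring }
  -- `g' w = q (π (i ↦ ∑ₗ bₗ · w (l, i)))`
  let g' : (L × Fin s → U) →ₗ[U] N :=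
    q ∘ₗ (π.restrictScalars U) ∘ₗ
      { toFun := fun w i => ∑ l, b l * algebraMap U V (w (l, i))
        map_add' := fun w w' => by
          funext i
          simp only [Pi.add_apply, map_add, mul_add, sum_add_distrib]
        map_smul' := fun r w => by
          funext i
          rw [RingHom.id_apply, Pi.smul_apply, Finset.smul_sum]
          refine sum_congr rfl fun l _ => ?_
          rw [Pi.smul_apply, smul_eq_mul, map_mul, Algebra.smul_def]
          ring }
  refine ⟨f', g', LinearMap.ext fun n => ?_⟩
  have hkey : (fun i => ∑ l, b l * algebraMap U V (ρ (b' l * ι (j n) i))) = a • ι (j n) := by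
    funext i
    rw [Pi.smul_apply, smul_eq_mul]
    exact havg (ι (j n) i)
  have hπι' : π (ι (j n)) = c • j n := LinearMap.congr_fun hπι (j n)
  change q (π (fun i => ∑ l, b l * algebraMap U V (ρ (b' l * ι (j n) i)))) = u • n
  rw [hkey, map_smul, hπι', smul_smul, ← hu, algebraMap_smul, ← LinearMap.map_smul_of_tower j u n]
  · exact hqj _

/-- A factorisation of `x • id_N` through a finite free module `L → T` (any finite index type, any universe) makes
`x` stably annihilate `ModuleCat.of T N` (re-index by `Fin (card L)` and use `stablyAnnihilates_of_linearMap`). [folklore] -/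
theorem stablyAnnihilates_of_linearMap_fintype {T : Type u} [CommRing T] {N : Type u} [AddCommGroup N] [Module T N]
    {x : T} {L : Type*} [Fintype L] (f : N →ₗ[T] (L → T)) (g : (L → T) →ₗ[T] N) (h : g ∘ₗ f = x • LinearMap.id) :
    StablyAnnihilates T x (ModuleCat.of T N) := by
  let E : (L → T) ≃ₗ[T] (Fin (Fintype.card L) → T) := LinearEquiv.funCongrLeft T T (Fintype.equivFin L).symm
  refine stablyAnnihilates_of_linearMap (E.toLinearMap ∘ₗ f) (g ∘ₗ E.symm.toLinearMap) ?_
  ext n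
  have hn : g (f n) = x • n := LinearMap.congr_fun h n
  simp [hn]

/-- **TRANSFER FROM AN AVERAGING IDENTITY (CA-layer form).**  With `ρ`, `bₗ`, `b′ₗ`, `a` as in
`exists_comp_eq_smul_id_of_averaging'`: if `c` stably annihilates the `V`-module `M` and `N` is a `U`-linear retract
of `M|_U` (`q ∘ j = id`), then `u` with `algebraMap u = a·c` stably annihilates `N` over `U`. [folklore mechanism] -/
theorem StablyAnnihilates.of_averaging (ρ : V →ₗ[U] U) {L : Type*} [Fintype L] (b b' : L → V) (a : V)
    (havg : ∀ w : V, ∑ l, b l * algebraMap U V (ρ (b' l * w)) = a * w)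
    {M : Type u} [AddCommGroup M] [Module V M] [Module U M] [IsScalarTower U V M]
    {N : Type u} [AddCommGroup N] [Module U N] (j : N →ₗ[U] M) (q : M →ₗ[U] N) (hqj : ∀ n, q (j n) = n)
    {c : V} (hc : StablyAnnihilates V c (ModuleCat.of V M)) (u : U) (hu : algebraMap U V u = a * c) :
    StablyAnnihilates U u (ModuleCat.of U N) := by
  obtain ⟨s, ι, π, hπι⟩ := (stablyAnnihilates_iff_exists_linearMap c (ModuleCat.of V M)).mp hc
  obtain ⟨f', g', h⟩ := exists_comp_eq_smul_id_of_averaging' ρ b b' a havg j q hqj ι π hπι u hu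
  exact stablyAnnihilates_of_linearMap_fintype f' g' h

end Averaging

/-! ## §2 Averaging identities from a grading -/

section Graded

variable {U V : Type u} [CommRing U] [CommRing V] [Algebra U V] {G : Type*} [AddCommGroup G] [Fintype G]
  [DecidableEq G]

/-- **Degree bookkeeping.**  Let `e x : V → V` (`x ∈ G`) be `U`-linear projectors with `∑ₓ eₓ = id`,
`eₓ ∘ e_y = δ_{xy} e_y`, and `V_x · V_y ⊆ V_{x+y}` (`eₓ v = v`, `e_y w = w` ⇒ `e_{x+y}(vw) = vw`).  Then for `b′` of
degree `−x`: `e₀(b′ · w) = b′ · eₓ(w)`. [folklore] -/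
theorem proj_zero_mul_eq_of_graded (e : G → (V →ₗ[U] V)) (he_sum : ∀ w, ∑ x, e x w = w)
    (he_proj : ∀ x y w, e x (e y w) = if x = y then e y w else 0)
    (he_mul : ∀ x y (v w : V), e x v = v → e y w = w → e (x + y) (v * w) = v * w)
    (x : G) (b' : V) (hb' : e (-x) b' = b') (w : V) : e 0 (b' * w) = b' * e x w := by
  conv_lhs => rw [← he_sum w, mul_sum, map_sum]
  have hterm : ∀ y, e 0 (b' * e y w) = if y = x then b' * e x w else 0 := by
    intro y
    have hy : e y (e y w) = e y w := by rw [he_proj, if_pos rfl]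
    have hhom : e (-x + y) (b' * e y w) = b' * e y w := he_mul (-x) y b' (e y w) hb' hy
    by_cases hyx : y = x
    · subst hyx
      rw [neg_add_cancel] at hhom
      rw [if_pos rfl, hhom]
    · have h0 := he_proj 0 (-x + y) (b' * e y w)
      rw [hhom] at h0
      rw [h0, if_neg hyx, if_neg]
      intro h
      apply hyx
      rw [neg_add_eq_sub, eq_comm, sub_eq_zero] at h
      exact h
  simp only [hterm, sum_ite_eq', mem_univ, if_true]

/-- **AVERAGING FROM A GRADING.**  With projectors `eₓ` as above and a `U`-linear `ρ : V → U` realising the degree-`0`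
part (`algebraMap (ρ v) = e₀ v`): if `a ∈ V` admits, for EVERY `x ∈ G`, a decomposition `a = ∑ₖ bₖ b′ₖ` with
`b′ₖ ∈ V_{−x}`, then `∑_{x,k} bₖ · ρ(b′ₖ · w) = a · w` for all `w` — the averaging identity of §1, with NO division by
`|G|` and no root of unity. [this work] -/
theorem averaging_of_graded (e : G → (V →ₗ[U] V)) (he_sum : ∀ w, ∑ x, e x w = w)
    (he_proj : ∀ x y w, e x (e y w) = if x = y then e y w else 0)
    (he_mul : ∀ x y (v w : V), e x v = v → e y w = w → e (x + y) (v * w) = v * w)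
    (ρ : V →ₗ[U] U) (hρ : ∀ v, algebraMap U V (ρ v) = e 0 v) (a : V) (n : G → ℕ)
    (b b' : (x : G) → Fin (n x) → V) (hb' : ∀ x k, e (-x) (b' x k) = b' x k)
    (hsum : ∀ x, ∑ k, b x k * b' x k = a) (w : V) :
    ∑ l : (Σ x : G, Fin (n x)), b l.1 l.2 * algebraMap U V (ρ (b' l.1 l.2 * w)) = a * w := by
  rw [Fintype.sum_sigma]
  have hinner : ∀ x, ∑ k, b x k * algebraMap U V (ρ (b' x k * w)) = a * e x w := by
    intro x
    simp only [hρ, proj_zero_mul_eq_of_graded e he_sum he_proj he_mul x _ (hb' x _) w, ← mul_assoc, ← sum_mul,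
      hsum x]
  simp only [hinner, ← mul_sum, he_sum]

/-- **GRADED TRANSFER (CA-layer form).**  `V = ⊕ₓ Vₓ` graded over `U = V₀` as above (`ρ` the degree-`0` part),
`a = ∑ₖ bₖ b′ₖ` with `b′ₖ ∈ V_{−x}` for every `x`, `c` stably annihilating a `V`-module `M`, `N` a `U`-linear retract of
`M|_U`, `algebraMap u = a·c` ⇒ `u` stably annihilates `N` over `U`.  (Stub-4's `StablyAnnihilates.fixed_of_isotypic_group`
without `|G| ∈ Uˣ`, characters, or a `G`-action on `M`.) [this work] -/
theorem StablyAnnihilates.of_graded (e : G → (V →ₗ[U] V)) (he_sum : ∀ w, ∑ x, e x w = w)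
    (he_proj : ∀ x y w, e x (e y w) = if x = y then e y w else 0)
    (he_mul : ∀ x y (v w : V), e x v = v → e y w = w → e (x + y) (v * w) = v * w)
    (ρ : V →ₗ[U] U) (hρ : ∀ v, algebraMap U V (ρ v) = e 0 v) {a : V} (n : G → ℕ)
    (b b' : (x : G) → Fin (n x) → V) (hb' : ∀ x k, e (-x) (b' x k) = b' x k) (hsum : ∀ x, ∑ k, b x k * b' x k = a)
    {M : Type u} [AddCommGroup M] [Module V M] [Module U M] [IsScalarTower U V M]
    {N : Type u} [AddCommGroup N] [Module U N] (j : N →ₗ[U] M) (q : M →ₗ[U] N) (hqj : ∀ n, q (j n) = n)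
    {c : V} (hc : StablyAnnihilates V c (ModuleCat.of V M)) (u : U) (hu : algebraMap U V u = a * c) :
    StablyAnnihilates U u (ModuleCat.of U N) := by
  exact StablyAnnihilates.of_averaging (L := Σ x : G, Fin (n x)) ρ (fun l => b l.1 l.2) (fun l => b' l.1 l.2) a
    (averaging_of_graded e he_sum he_proj he_mul ρ hρ a n b b' hb' hsum) j q hqj hc u hu

end Graded



end Summit.ResolutionOfSingularities.ResolutionOfSingularities.Theorems.HomologicalConductor.PersistenceGradedTransfer

end
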